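import Summits.CriticalPhenomena.CardyFormulaZ2.Theorems.CardyGluingRDEContractionGivesMerging
import Literature.Probability.Percolation.CardyFormulaConformalInvariance
import Literature.Probability.Percolation.ZdNearCriticalWindow
import Literature.Probability.Percolation.SiteConnectionTools
import Literature.Probability.LatticeModels.TriangularLatticeProofs
import Literature.Probability.RandomPlanarGeometry.MarkedDomainCorners

/-!
# Route `CardyGluingRDE`, item `Assembly` (stmt-CriticalPhenomena-14373): dyadic-marked squares

The item `Assembly : GluingContraction → CardyFormulaZ2` is, on the thesis, equivalent to the
conjunction of the open glue items `MergingGivesPolygonCardy` (stmt-8584) and `PolygonReduction`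
(stmt-4784) (`Assembly_iff_glue_of_gluingContraction`).  This file proves its CONCLUSION — Cardy's
formula for bond percolation on `ℤ²` at `p = 1/2`, G02 discretisation — on the sub-family the
thesis speaks about: open squares `(0, δ₀)²` whose crossing arcs `R.arc 0`, `R.arc 2` are unions
of closed level-`j` dyadic boundary segments (any `j`, any boundary parametrisation); the one-cell
case of the polyomino transfer (no seam, no shadowing).  New ingredient, EVENT MATCHING for unions:
`GluingRDESquare.discreteArc_biUnion` / `triDiscreteArc_biUnion` (the G02 discrete arc of a finite
union of boundary pieces is the union of their discrete arcs — the `infDist` bookkeeping of step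
(i) of the plan of stmt-8584, both lattices), `discreteCrossing_biUnion` / `triCrossing_biUnion`
(crossing event between unions of segments = READOUT `∃ a ∈ S, ∃ b ∈ T, M a b` of the segment
matrix), `measureReal_readout_eq_sum` / `abs_measureReal_readout_sub_le` (cells
`{∀ a b, ω ∈ E a b ↔ M a b}` = the route's `EZ`/`ET` partition a readout; single-index analogues
were landed in parallel in `CardyGluingRDEBoxMergingSquareCardy.lean`, corner-marked square).
Results: `abs_bondDomainCrossingProb_sub_triDomainCrossingProb_le`
(`|bond R u - tri R u'| ≤ 2·TV_j(u,u')`, route's `TV` verbatim),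
`hasCrossingLimit_dyadicSquare_of_boxMerging` (`BoxMerging ⇒` Cardy on bond-`ℤ²` for every
dyadic-marked square, via Smirnov's theorem on `𝕋`, `hasCrossingLimit_triDomainCrossingProb_holds`)
and `hasCrossingLimit_dyadicSquare_of_gluingContraction` (the item restricted to this family).
References: Smirnov, C. R. Acad. Sci. 333 (2001) §2; Schramm–Smirnov, EJP 16 (2011) §1;
Langlands–Pouliot–Saint-Aubin, Bull. AMS 30 (1994) §2.3.
-/

noncomputable section

namespace Summit.CriticalPhenomena.CardyFormulaZ2.Theorems

open scoped Classical
open Set Metric MeasureTheory Filter Topology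
open Literature.Probability.Percolation Literature.Probability.LatticeModels
open Literature.Probability.RandomPlanarGeometry (ConformalRectangle)
open Summit.CriticalPhenomena.CardyFormulaZ2.Theses.CardyGluingRDE

namespace GluingRDESquare

/-! ### `infDist` bookkeeping: discrete arcs of unions of boundary pieces -/

/-- **Nearest-piece bookkeeping.** For a nonempty finite family of nonempty sets `A i` not
exhausting `F`, a point is at least as close to `⋃ A i` as to `F \ ⋃ A i` iff it is at least as
close to SOME piece `A i` as to `F \ A i` (the piece realising the distance works). [folklore] -/
theorem infDist_biUnion_le_iff {ι : Type*} (p : ℂ) (F : Set ℂ) (S : Finset ι) (A : ι → Set ℂ)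
    (hS : S.Nonempty) (hne : ∀ i ∈ S, (A i).Nonempty) (hF : (F \ ⋃ i ∈ S, A i).Nonempty) :
    infDist p (⋃ i ∈ S, A i) ≤ infDist p (F \ ⋃ i ∈ S, A i) ↔
      ∃ i ∈ S, infDist p (A i) ≤ infDist p (F \ A i) := by
  have hsub : ∀ i ∈ S, F \ ⋃ k ∈ S, A k ⊆ F \ A i := fun i hi =>
    Set.sdiff_subset_sdiff_right (subset_biUnion_of_mem (u := A) hi)
  constructor
  · intro h
    -- the piece realising the distance to the union
    obtain ⟨i₀, hi₀, hmin⟩ := S.exists_min_image (fun i => infDist p (A i)) hS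
    have hU : (⋃ i ∈ S, A i).Nonempty := by
      obtain ⟨y, hy⟩ := hne i₀ hi₀
      exact ⟨y, mem_biUnion hi₀ hy⟩
    have hle : infDist p (A i₀) ≤ infDist p (⋃ i ∈ S, A i) := by
      refine (le_infDist hU).2 fun y hy => ?_
      obtain ⟨i, hi, hyi⟩ := mem_iUnion₂.1 hy
      exact (hmin i hi).trans (infDist_le_dist_of_mem hyi)
    have hge : infDist p (⋃ i ∈ S, A i) ≤ infDist p (A i₀) :=
      infDist_le_infDist_of_subset (subset_biUnion_of_mem (u := A) hi₀) (hne i₀ hi₀)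
    refine ⟨i₀, hi₀, (le_infDist ((hF.mono (hsub i₀ hi₀)))).2 fun y hy => ?_⟩
    by_cases hyU : y ∈ ⋃ i ∈ S, A i
    · obtain ⟨i, hi, hyi⟩ := mem_iUnion₂.1 hyU
      exact (hmin i hi).trans (infDist_le_dist_of_mem hyi)
    · exact hle.trans (h.trans (infDist_le_dist_of_mem ⟨hy.1, hyU⟩))
  · rintro ⟨i, hi, h⟩
    calc infDist p (⋃ k ∈ S, A k) ≤ infDist p (A i) :=
          infDist_le_infDist_of_subset (subset_biUnion_of_mem (u := A) hi) (hne i hi)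
      _ ≤ infDist p (F \ A i) := h
      _ ≤ infDist p (F \ ⋃ k ∈ S, A k) := infDist_le_infDist_of_subset (hsub i hi) hF

/-- **The G02 discrete arc of a union of boundary pieces is the union of their discrete arcs**
(bond-`ℤ²` discretisation `discreteArc`): pieces nonempty, finitely many, at least one, and not
covering the whole frontier. [folklore] -/
theorem discreteArc_biUnion {ι : Type*} (Ω : Set ℂ) (δ : ℝ) (S : Finset ι) (A : ι → Set ℂ)
    (hS : S.Nonempty) (hne : ∀ i ∈ S, (A i).Nonempty)
    (hF : (frontier Ω \ ⋃ i ∈ S, A i).Nonempty) :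
    discreteArc Ω δ (⋃ i ∈ S, A i) = ⋃ i ∈ S, discreteArc Ω δ (A i) := by
  ext x
  simp only [mem_discreteArc_iff, mem_iUnion, exists_prop]
  rw [infDist_biUnion_le_iff _ _ S A hS hne hF]
  constructor
  · rintro ⟨hx, i, hi, h⟩
    exact ⟨i, hi, hx, h⟩
  · rintro ⟨i, hi, hx, h⟩
    exact ⟨hx, i, hi, h⟩

/-- **The G02 discrete arc of a union of boundary pieces is the union of their discrete arcs**
(site-`𝕋` discretisation `triDiscreteArc`). [folklore] -/
theorem triDiscreteArc_biUnion {ι : Type*} (Ω : Set ℂ) (δ : ℝ) (S : Finset ι) (A : ι → Set ℂ)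
    (hS : S.Nonempty) (hne : ∀ i ∈ S, (A i).Nonempty)
    (hF : (frontier Ω \ ⋃ i ∈ S, A i).Nonempty) :
    triDiscreteArc Ω δ (⋃ i ∈ S, A i) = ⋃ i ∈ S, triDiscreteArc Ω δ (A i) := by
  ext x
  simp only [mem_triDiscreteArc_iff, mem_iUnion, exists_prop]
  rw [infDist_biUnion_le_iff _ _ S A hS hne hF]
  constructor
  · rintro ⟨hx, i, hi, h⟩
    exact ⟨i, hi, hx, h⟩
  · rintro ⟨i, hi, hx, h⟩
    exact ⟨hx, i, hi, h⟩

/-- **Crossing events between unions of boundary pieces decompose** (bond-`ℤ²`): the G02 crossing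
event between `⋃ A i` and `⋃ B k` is the union of the crossing events between the pieces.
[folklore] -/
theorem discreteCrossing_biUnion {ι κ : Type*} (Ω : Set ℂ) (δ : ℝ) (S : Finset ι) (A : ι → Set ℂ)
    (T : Finset κ) (B : κ → Set ℂ) (hS : S.Nonempty) (hneA : ∀ i ∈ S, (A i).Nonempty)
    (hFA : (frontier Ω \ ⋃ i ∈ S, A i).Nonempty) (hT : T.Nonempty) (hneB : ∀ k ∈ T, (B k).Nonempty)
    (hFB : (frontier Ω \ ⋃ k ∈ T, B k).Nonempty) :
    discreteCrossing Ω δ (⋃ i ∈ S, A i) (⋃ k ∈ T, B k) =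
      ⋃ i ∈ S, ⋃ k ∈ T, discreteCrossing Ω δ (A i) (B k) := by
  ext ω
  simp only [mem_discreteCrossing_iff, discreteArc_biUnion Ω δ S A hS hneA hFA,
    discreteArc_biUnion Ω δ T B hT hneB hFB, mem_iUnion, exists_prop]
  constructor
  · rintro ⟨x, ⟨i, hi, hx⟩, y, ⟨k, hk, hy⟩, h⟩
    exact ⟨i, hi, k, hk, x, hx, y, hy, h⟩
  · rintro ⟨i, hi, k, hk, x, hx, y, hy, h⟩
    exact ⟨x, ⟨i, hi, hx⟩, y, ⟨k, hk, hy⟩, h⟩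

/-- **Crossing events between unions of boundary pieces decompose** (site-`𝕋`). [folklore] -/
theorem triCrossing_biUnion {ι κ : Type*} (Ω : Set ℂ) (δ : ℝ) (S : Finset ι) (A : ι → Set ℂ)
    (T : Finset κ) (B : κ → Set ℂ) (hS : S.Nonempty) (hneA : ∀ i ∈ S, (A i).Nonempty)
    (hFA : (frontier Ω \ ⋃ i ∈ S, A i).Nonempty) (hT : T.Nonempty) (hneB : ∀ k ∈ T, (B k).Nonempty)
    (hFB : (frontier Ω \ ⋃ k ∈ T, B k).Nonempty) :
    triCrossing Ω δ (⋃ i ∈ S, A i) (⋃ k ∈ T, B k) =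
      ⋃ i ∈ S, ⋃ k ∈ T, triCrossing Ω δ (A i) (B k) := by
  ext ω
  simp only [triCrossing, mem_setOf_eq, triDiscreteArc_biUnion Ω δ S A hS hneA hFA,
    triDiscreteArc_biUnion Ω δ T B hT hneB hFB, mem_iUnion, exists_prop]
  constructor
  · rintro ⟨x, ⟨i, hi, hx⟩, y, ⟨k, hk, hy⟩, h⟩
    exact ⟨i, hi, k, hk, x, hx, y, hy, h⟩
  · rintro ⟨i, hi, k, hk, x, hx, y, hy, h⟩
    exact ⟨x, ⟨i, hi, hx⟩, y, ⟨k, hk, hy⟩, h⟩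

/-! ### Readout events and their cells -/

section Readout

variable {Ω' α β : Type*} [MeasurableSpace Ω'] [Fintype α] [Fintype β]

/-- Cells of a readout by measurable events are measurable. [folklore] -/
theorem measurableSet_cell (E : α → β → Set Ω') (hE : ∀ a b, MeasurableSet (E a b))
    (M : α → β → Bool) : MeasurableSet {ω | ∀ a b, ω ∈ E a b ↔ M a b = true} := by
  have h : {ω | ∀ a b, ω ∈ E a b ↔ M a b = true} =
      ⋂ a, ⋂ b, (if M a b = true then E a b else (E a b)ᶜ) := by
    ext ω
    simp only [mem_setOf_eq, mem_iInter]
    refine forall_congr' fun a => forall_congr' fun b => ?_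
    cases M a b <;> simp
  rw [h]
  exact MeasurableSet.iInter fun a => MeasurableSet.iInter fun b => by
    split_ifs
    · exact hE a b
    · exact (hE a b).compl

/-- **A readout event is the disjoint union of its cells**: the measure of
`⋃ a ∈ S, ⋃ b ∈ T, E a b` is the sum, over the matrices `M` with an accepted entry, of the measures
of the cells `{∀ a b, ω ∈ E a b ↔ M a b}`. [folklore] -/
theorem measureReal_readout_eq_sum [DecidableEq α] [DecidableEq β] (μ : Measure Ω')
    [IsFiniteMeasure μ] (E : α → β → Set Ω') (hE : ∀ a b, MeasurableSet (E a b)) (S : Finset α)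
    (T : Finset β) :
    μ.real (⋃ a ∈ S, ⋃ b ∈ T, E a b) =
      ∑ M ∈ (Finset.univ.filter fun M : α → β → Bool => ∃ a ∈ S, ∃ b ∈ T, M a b = true),
        μ.real {ω | ∀ a b, ω ∈ E a b ↔ M a b = true} := by
  set G := (Finset.univ.filter fun M : α → β → Bool => ∃ a ∈ S, ∃ b ∈ T, M a b = true) with hG
  have hunion : (⋃ a ∈ S, ⋃ b ∈ T, E a b) = ⋃ M ∈ G, {ω | ∀ a b, ω ∈ E a b ↔ M a b = true} := by
    ext ω
    simp only [mem_iUnion, exists_prop, mem_setOf_eq, hG, Finset.mem_filter, Finset.mem_univ,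
      true_and]
    constructor
    · rintro ⟨a, ha, b, hb, hω⟩
      exact ⟨fun a b => decide (ω ∈ E a b), ⟨a, ha, b, hb, by simpa using hω⟩, fun a b => by simp⟩
    · rintro ⟨M, ⟨a, ha, b, hb, hM⟩, hω⟩
      exact ⟨a, ha, b, hb, (hω a b).2 hM⟩
  rw [hunion]
  refine measureReal_biUnion_finset (fun M _ M' _ hMM' => ?_) fun M _ => measurableSet_cell E hE M
  exact disjoint_left.2 fun ω hω hω' => hMM' (funext fun a => funext fun b =>
    Bool.eq_iff_iff.2 ((hω a b).symm.trans (hω' a b)))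

/-- **Two readouts of the same shape differ by at most the `ℓ¹` distance of their cell laws**:
`|μ(readout) - ν(readout')| ≤ Σ_M |μ(cell M) - ν(cell' M)|` (sum over ALL matrices). [folklore] -/
theorem abs_measureReal_readout_sub_le [DecidableEq α] [DecidableEq β] {Ω'' : Type*}
    [MeasurableSpace Ω''] (μ : Measure Ω') [IsFiniteMeasure μ] (ν : Measure Ω'') [IsFiniteMeasure ν]
    (E : α → β → Set Ω') (E' : α → β → Set Ω'') (hE : ∀ a b, MeasurableSet (E a b))
    (hE' : ∀ a b, MeasurableSet (E' a b)) (S : Finset α) (T : Finset β) :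
    |μ.real (⋃ a ∈ S, ⋃ b ∈ T, E a b) - ν.real (⋃ a ∈ S, ⋃ b ∈ T, E' a b)| ≤
      ∑ M : α → β → Bool, |μ.real {ω | ∀ a b, ω ∈ E a b ↔ M a b = true} -
        ν.real {ω | ∀ a b, ω ∈ E' a b ↔ M a b = true}| := by
  rw [measureReal_readout_eq_sum μ E hE S T, measureReal_readout_eq_sum ν E' hE' S T,
    ← Finset.sum_sub_distrib]
  exact (Finset.abs_sum_le_sum_abs _ _).trans (Finset.sum_le_univ_sum_of_nonneg fun M =>
    abs_nonneg _)

end Readout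

/-- The G02 crossing event of site percolation on `δ𝕋` is measurable as soon as the discrete
domain `Ω_δ` is finite (bounded `Ω`, `δ > 0`: `triMeshDomain_finite_holds`). [folklore] -/
theorem measurableSet_triCrossing_of_finite {Ω : Set ℂ} {δ : ℝ}
    (hfin : (triMeshDomain Ω δ).Finite) (A B : Set ℂ) : MeasurableSet (triCrossing Ω δ A B) := by
  have heq : triCrossing Ω δ A B = ⋃ x ∈ triDiscreteArc Ω δ A, ⋃ y ∈ triDiscreteArc Ω δ B,
      siteConnIn (triDiscreteDomainGraph Ω δ) (↑hfin.toFinset) x y := by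
    ext ω
    simp only [triCrossing, mem_setOf_eq, mem_iUnion, exists_prop, Finite.coe_toFinset]
  rw [heq]
  exact MeasurableSet.biUnion (to_countable _) fun x _ =>
    MeasurableSet.biUnion (to_countable _) fun y _ => measurableSet_siteConnIn _ _ x y

/-- The dyadic boundary segments of the square are nonempty (for `δ₀ ≥ 0`). [folklore] -/
theorem seg_nonempty {δ₀ : ℝ} (hδ₀ : 0 ≤ δ₀) (j : ℕ) (a : Fin 4 × Fin (2 ^ j)) :
    {z : ℂ | (a.1 = 0 ∧ z.im = 0 ∧ δ₀ * ((a.2 : ℕ) : ℝ) / 2 ^ j ≤ z.re ∧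
        z.re ≤ δ₀ * (((a.2 : ℕ) : ℝ) + 1) / 2 ^ j) ∨
      (a.1 = 1 ∧ z.re = δ₀ ∧ δ₀ * ((a.2 : ℕ) : ℝ) / 2 ^ j ≤ z.im ∧
        z.im ≤ δ₀ * (((a.2 : ℕ) : ℝ) + 1) / 2 ^ j) ∨
      (a.1 = 2 ∧ z.im = δ₀ ∧ δ₀ * ((a.2 : ℕ) : ℝ) / 2 ^ j ≤ z.re ∧
        z.re ≤ δ₀ * (((a.2 : ℕ) : ℝ) + 1) / 2 ^ j) ∨
      (a.1 = 3 ∧ z.re = 0 ∧ δ₀ * ((a.2 : ℕ) : ℝ) / 2 ^ j ≤ z.im ∧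
        z.im ≤ δ₀ * (((a.2 : ℕ) : ℝ) + 1) / 2 ^ j)}.Nonempty := by
  obtain ⟨d, t⟩ := a
  have hmono : δ₀ * ((t : ℕ) : ℝ) / 2 ^ j ≤ δ₀ * (((t : ℕ) : ℝ) + 1) / 2 ^ j :=
    div_le_div_of_nonneg_right (by nlinarith) (by positivity)
  fin_cases d
  · exact ⟨⟨δ₀ * ((t : ℕ) : ℝ) / 2 ^ j, 0⟩, Or.inl ⟨rfl, rfl, le_rfl, hmono⟩⟩
  · exact ⟨⟨δ₀, δ₀ * ((t : ℕ) : ℝ) / 2 ^ j⟩, Or.inr (Or.inl ⟨rfl, rfl, le_rfl, hmono⟩)⟩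
  · exact ⟨⟨δ₀ * ((t : ℕ) : ℝ) / 2 ^ j, δ₀⟩, Or.inr (Or.inr (Or.inl ⟨rfl, rfl, le_rfl, hmono⟩))⟩
  · exact ⟨⟨0, δ₀ * ((t : ℕ) : ℝ) / 2 ^ j⟩, Or.inr (Or.inr (Or.inr ⟨rfl, rfl, le_rfl, hmono⟩))⟩

end GluingRDESquare

open GluingRDESquare

/-! ### The square case of the polyomino transfer -/

/-- **Event matching for a dyadic-marked square.** For a conformal rectangle `R` with carrier
the open square `(0, δ₀)²` whose crossing arcs `R.arc 0`, `R.arc 2` are unions of closed level-`j`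
dyadic boundary segments (`seg δ₀ j a`, `a ∈ S`, resp. `b ∈ T`), every `ℤ²`-mesh `u` and every
`𝕋`-mesh `u' > 0`: `|bondDomainCrossingProb R u - triDomainCrossingProb R u'| ≤ 2 · TV δ₀ j u u'`
(the `let`s `PZ PT Sq seg EZ ET TV` are those of `BoxMerging`, verbatim): both crossing events
are the same readout of the respective segment matrices (`discreteCrossing_biUnion`,
`triCrossing_biUnion`), and two readouts differ by at most the `ℓ¹` distance of the cell laws
(`abs_measureReal_readout_sub_le`). [folklore] -/
theorem abs_bondDomainCrossingProb_sub_triDomainCrossingProb_le (R : ConformalRectangle)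
    {δ₀ : ℝ} (hδ₀ : 0 < δ₀) (j : ℕ) (S T : Finset (Fin 4 × Fin (2 ^ j))) (hS : S.Nonempty)
    (hT : T.Nonempty) :
    let PZ := Literature.Probability.Percolation.bondPercolation
      (Literature.Probability.LatticeModels.zdGraph 2) Literature.Probability.Percolation.half
    let PT := Literature.Probability.LatticeModels.triSitePercolation
      Literature.Probability.Percolation.half
    let Sq : ℝ → Set ℂ := fun δ₀ => {z : ℂ | 0 < z.re ∧ z.re < δ₀ ∧ 0 < z.im ∧ z.im < δ₀}
    let seg : (δ₀ : ℝ) → (j : ℕ) → Fin 4 × Fin (2 ^ j) → Set ℂ := fun δ₀ j a =>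
      {z : ℂ | (a.1 = 0 ∧ z.im = 0 ∧ δ₀ * ((a.2 : ℕ) : ℝ) / 2 ^ j ≤ z.re ∧
          z.re ≤ δ₀ * (((a.2 : ℕ) : ℝ) + 1) / 2 ^ j) ∨
        (a.1 = 1 ∧ z.re = δ₀ ∧ δ₀ * ((a.2 : ℕ) : ℝ) / 2 ^ j ≤ z.im ∧
          z.im ≤ δ₀ * (((a.2 : ℕ) : ℝ) + 1) / 2 ^ j) ∨
        (a.1 = 2 ∧ z.im = δ₀ ∧ δ₀ * ((a.2 : ℕ) : ℝ) / 2 ^ j ≤ z.re ∧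
          z.re ≤ δ₀ * (((a.2 : ℕ) : ℝ) + 1) / 2 ^ j) ∨
        (a.1 = 3 ∧ z.re = 0 ∧ δ₀ * ((a.2 : ℕ) : ℝ) / 2 ^ j ≤ z.im ∧
          z.im ≤ δ₀ * (((a.2 : ℕ) : ℝ) + 1) / 2 ^ j)}
    let EZ : (δ₀ : ℝ) → (j : ℕ) → ℝ → ((Fin 4 × Fin (2 ^ j)) → (Fin 4 × Fin (2 ^ j)) → Bool) →
        Set (Literature.Probability.Percolation.BondConfig
          (Literature.Probability.LatticeModels.Site 2)) := fun δ₀ j u M =>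
      {ω | ∀ a b, ω ∈ Literature.Probability.Percolation.discreteCrossing (Sq δ₀) u (seg δ₀ j a)
        (seg δ₀ j b) ↔ M a b = true}
    let ET : (δ₀ : ℝ) → (j : ℕ) → ℝ → ((Fin 4 × Fin (2 ^ j)) → (Fin 4 × Fin (2 ^ j)) → Bool) →
        Set (Literature.Probability.Percolation.SiteConfig
          (Literature.Probability.LatticeModels.Site 2)) := fun δ₀ j u M =>
      {ω | ∀ a b, ω ∈ Literature.Probability.LatticeModels.triCrossing (Sq δ₀) u (seg δ₀ j a)
        (seg δ₀ j b) ↔ M a b = true}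
    let TV : ℝ → ℕ → ℝ → ℝ → ℝ := fun δ₀ j u u' => (1 / 2 : ℝ) *
      ∑ M : (Fin 4 × Fin (2 ^ j)) → (Fin 4 × Fin (2 ^ j)) → Bool,
        |PZ.real (EZ δ₀ j u M) - PT.real (ET δ₀ j u' M)|
    R.carrier = Sq δ₀ → R.arc 0 = ⋃ a ∈ S, seg δ₀ j a → R.arc 2 = ⋃ b ∈ T, seg δ₀ j b →
      ∀ u u' : ℝ, 0 < u' →
      |bondDomainCrossingProb R u - triDomainCrossingProb R u'| ≤ 2 * TV δ₀ j u u' := by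
  intro PZ PT Sq seg EZ ET TV hR h0 h2 u u' hu'
  -- the segments are nonempty and neither arc exhausts the frontier of the square
  have hseg : ∀ a ∈ S, (seg δ₀ j a).Nonempty := fun a _ => seg_nonempty hδ₀.le j a
  have hseg' : ∀ b ∈ T, (seg δ₀ j b).Nonempty := fun b _ => seg_nonempty hδ₀.le j b
  have hF0 : (frontier (Sq δ₀) \ ⋃ a ∈ S, seg δ₀ j a).Nonempty := by
    refine ⟨R.pt 2, ?_, ?_⟩
    · rw [← hR]; exact R.pt_mem_frontier 2
    · rw [← h0, R.pt_mem_arc_iff]; decide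
  have hF2 : (frontier (Sq δ₀) \ ⋃ b ∈ T, seg δ₀ j b).Nonempty := by
    refine ⟨R.pt 0, ?_, ?_⟩
    · rw [← hR]; exact R.pt_mem_frontier 0
    · rw [← h2, R.pt_mem_arc_iff]; decide
  have hbdd : Bornology.IsBounded (Sq δ₀) := hR ▸ R.isBounded
  -- both crossing events are readouts of the segment matrices
  have hZ : bondDomainCrossingProb R u =
      PZ.real (⋃ a ∈ S, ⋃ b ∈ T, discreteCrossing (Sq δ₀) u (seg δ₀ j a) (seg δ₀ j b)) := by
    rw [bondDomainCrossingProb_eq_measureReal, hR, h0, h2,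
      discreteCrossing_biUnion (Sq δ₀) u S (seg δ₀ j) T (seg δ₀ j) hS hseg hF0 hT hseg' hF2]
  have hT' : triDomainCrossingProb R u' =
      PT.real (⋃ a ∈ S, ⋃ b ∈ T, triCrossing (Sq δ₀) u' (seg δ₀ j a) (seg δ₀ j b)) := by
    rw [triDomainCrossingProb_eq_measureReal, hR, h0, h2,
      triCrossing_biUnion (Sq δ₀) u' S (seg δ₀ j) T (seg δ₀ j) hS hseg hF0 hT hseg' hF2]
  have h2TV : 2 * TV δ₀ j u u' =
      ∑ M : (Fin 4 × Fin (2 ^ j)) → (Fin 4 × Fin (2 ^ j)) → Bool,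
        |PZ.real (EZ δ₀ j u M) - PT.real (ET δ₀ j u' M)| := by
    show 2 * ((1 / 2 : ℝ) * _) = _
    ring
  rw [hZ, hT', h2TV]
  -- two readouts of the same shape differ by at most the `ℓ¹` distance of the state laws
  exact abs_measureReal_readout_sub_le PZ PT
    (fun a b => discreteCrossing (Sq δ₀) u (seg δ₀ j a) (seg δ₀ j b))
    (fun a b => triCrossing (Sq δ₀) u' (seg δ₀ j a) (seg δ₀ j b))
    (fun a b => measurableSet_discreteCrossing (Sq δ₀) u (seg δ₀ j a) (seg δ₀ j b))
    (fun a b => measurableSet_triCrossing_of_finite (triMeshDomain_finite_holds hbdd hu')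
      (seg δ₀ j a) (seg δ₀ j b)) S T

/-- **`BoxMerging` implies Cardy's formula on bond-`ℤ²` for every dyadic-marked square** (the
claim in the docstring of `BoxMerging`; one-cell case of the polyomino transfer): for `R` with
carrier `(0, δ₀)²` and crossing arcs unions of level-`j` dyadic segments,
`bondDomainCrossingProb R u → cardyFunction η_R` as `u → 0⁺` — `BoxMerging` makes the two square
laws `ε/4`-close in `TV_j`, so the two crossing probabilities of `R` are `ε/2`-close
(`abs_bondDomainCrossingProb_sub_triDomainCrossingProb_le`), and Smirnov's theorem on `𝕋`
(`hasCrossingLimit_triDomainCrossingProb_holds`) does the rest. `Sq seg` as in `BoxMerging`.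
[folklore] -/
theorem hasCrossingLimit_dyadicSquare_of_boxMerging (hBM : BoxMerging) :
    let Sq : ℝ → Set ℂ := fun δ₀ => {z : ℂ | 0 < z.re ∧ z.re < δ₀ ∧ 0 < z.im ∧ z.im < δ₀}
    let seg : (δ₀ : ℝ) → (j : ℕ) → Fin 4 × Fin (2 ^ j) → Set ℂ := fun δ₀ j a =>
      {z : ℂ | (a.1 = 0 ∧ z.im = 0 ∧ δ₀ * ((a.2 : ℕ) : ℝ) / 2 ^ j ≤ z.re ∧
          z.re ≤ δ₀ * (((a.2 : ℕ) : ℝ) + 1) / 2 ^ j) ∨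
        (a.1 = 1 ∧ z.re = δ₀ ∧ δ₀ * ((a.2 : ℕ) : ℝ) / 2 ^ j ≤ z.im ∧
          z.im ≤ δ₀ * (((a.2 : ℕ) : ℝ) + 1) / 2 ^ j) ∨
        (a.1 = 2 ∧ z.im = δ₀ ∧ δ₀ * ((a.2 : ℕ) : ℝ) / 2 ^ j ≤ z.re ∧
          z.re ≤ δ₀ * (((a.2 : ℕ) : ℝ) + 1) / 2 ^ j) ∨
        (a.1 = 3 ∧ z.re = 0 ∧ δ₀ * ((a.2 : ℕ) : ℝ) / 2 ^ j ≤ z.im ∧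
          z.im ≤ δ₀ * (((a.2 : ℕ) : ℝ) + 1) / 2 ^ j)}
    ∀ (R : ConformalRectangle) (δ₀ : ℝ), 0 < δ₀ → ∀ (j : ℕ) (S T : Finset (Fin 4 × Fin (2 ^ j))),
      S.Nonempty → T.Nonempty → R.carrier = Sq δ₀ → R.arc 0 = ⋃ a ∈ S, seg δ₀ j a →
      R.arc 2 = ⋃ b ∈ T, seg δ₀ j b →
      R.HasCrossingLimit (bondDomainCrossingProb R)
        Literature.Probability.RandomPlanarGeometry.cardyFunction := by
  intro Sq seg R δ₀ hδ₀ j S T hS hT hR h0 h2 φ x hux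
  have htri := hasCrossingLimit_triDomainCrossingProb_holds R φ x hux
  rw [Metric.tendsto_nhdsWithin_nhds] at htri ⊢
  intro ε hε
  obtain ⟨η, hη, hTV⟩ := hBM δ₀ hδ₀ j (ε / 4) (by positivity)
  obtain ⟨η₃, hη₃, htri'⟩ := htri (ε / 2) (by positivity)
  refine ⟨η, hη, fun u hu hdist => ?_⟩
  -- a fixed small `𝕋`-mesh `u'`
  set u' : ℝ := min η η₃ / 2 with hu'
  have hm : 0 < min η η₃ := lt_min hη hη₃
  have hu'pos : 0 < u' := by positivity
  have hu'lt : u' < min η η₃ := by rw [hu']; linarith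
  have hu'η : u' < η := hu'lt.trans_le (min_le_left _ _)
  have hu'η₃ : u' < η₃ := hu'lt.trans_le (min_le_right _ _)
  rw [Real.dist_eq, sub_zero, abs_of_pos hu] at hdist
  -- event matching + `BoxMerging`: the two crossing probabilities of `R` are `ε/2`-close
  have h1 :=
    abs_bondDomainCrossingProb_sub_triDomainCrossingProb_le R hδ₀ j S T hS hT hR h0 h2 u u' hu'pos
  have h1' := hTV u u' hu hdist hu'pos hu'η
  -- Smirnov on `𝕋`
  set c : ℝ := Literature.Probability.RandomPlanarGeometry.cardyFunction
    (Literature.Probability.RandomPlanarGeometry.crossRatio x)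
  have h3 : dist (triDomainCrossingProb R u') c < ε / 2 :=
    htri' (show u' ∈ Ioi (0 : ℝ) from hu'pos) (by rwa [Real.dist_eq, sub_zero, abs_of_pos hu'pos])
  rw [Real.dist_eq] at h3 ⊢
  calc |bondDomainCrossingProb R u - c|
      = |(bondDomainCrossingProb R u - triDomainCrossingProb R u') +
          (triDomainCrossingProb R u' - c)| := by ring_nf
    _ ≤ |bondDomainCrossingProb R u - triDomainCrossingProb R u'| +
          |triDomainCrossingProb R u' - c| := abs_add_le _ _
    _ < ε := by linarith

/-- **The thesis implies Cardy's formula on bond-`ℤ²` for every dyadic-marked square**: item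
`Assembly` (stmt-CriticalPhenomena-14373) restricted to conformal rectangles with carrier
`(0, δ₀)²` and crossing arcs unions of level-`j` dyadic segments, through the proved glue
`ContractionGivesMerging_proof`. `Sq seg` as in `GluingContraction`, verbatim. [folklore] -/
theorem hasCrossingLimit_dyadicSquare_of_gluingContraction (hX : GluingContraction) :
    let Sq : ℝ → Set ℂ := fun δ₀ => {z : ℂ | 0 < z.re ∧ z.re < δ₀ ∧ 0 < z.im ∧ z.im < δ₀}
    let seg : (δ₀ : ℝ) → (j : ℕ) → Fin 4 × Fin (2 ^ j) → Set ℂ := fun δ₀ j a =>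
      {z : ℂ | (a.1 = 0 ∧ z.im = 0 ∧ δ₀ * ((a.2 : ℕ) : ℝ) / 2 ^ j ≤ z.re ∧
          z.re ≤ δ₀ * (((a.2 : ℕ) : ℝ) + 1) / 2 ^ j) ∨
        (a.1 = 1 ∧ z.re = δ₀ ∧ δ₀ * ((a.2 : ℕ) : ℝ) / 2 ^ j ≤ z.im ∧
          z.im ≤ δ₀ * (((a.2 : ℕ) : ℝ) + 1) / 2 ^ j) ∨
        (a.1 = 2 ∧ z.im = δ₀ ∧ δ₀ * ((a.2 : ℕ) : ℝ) / 2 ^ j ≤ z.re ∧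
          z.re ≤ δ₀ * (((a.2 : ℕ) : ℝ) + 1) / 2 ^ j) ∨
        (a.1 = 3 ∧ z.re = 0 ∧ δ₀ * ((a.2 : ℕ) : ℝ) / 2 ^ j ≤ z.im ∧
          z.im ≤ δ₀ * (((a.2 : ℕ) : ℝ) + 1) / 2 ^ j)}
    ∀ (R : ConformalRectangle) (δ₀ : ℝ), 0 < δ₀ → ∀ (j : ℕ) (S T : Finset (Fin 4 × Fin (2 ^ j))),
      S.Nonempty → T.Nonempty → R.carrier = Sq δ₀ → R.arc 0 = ⋃ a ∈ S, seg δ₀ j a →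
      R.arc 2 = ⋃ b ∈ T, seg δ₀ j b →
      R.HasCrossingLimit (bondDomainCrossingProb R)
        Literature.Probability.RandomPlanarGeometry.cardyFunction :=
  hasCrossingLimit_dyadicSquare_of_boxMerging (ContractionGivesMerging_proof hX)

end Summit.CriticalPhenomena.CardyFormulaZ2.Theorems
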